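import Literature.AlgebraicGeometry.Motives.FamiliesVHSMorphism
import HarnessLib

/-!
# Tate twists `D(j)` of the data of a polarized variation of Hodge structure: same local systems and forms, weight `k − 2j`, Hodge filtrations
# shifted by `j`; integral Hodge classes of level `p` of `D(j)` = those of level `p + j` of `D`; Hodge loci; twists of morphisms

Topic `Literature/AlgebraicGeometry/Motives` (namespace `Literature.AlgebraicGeometry.Motives.VHSData`), lane `lit-hodgefound` (seat `p08`, row g57-#2).
DEFINITIONS WITH BODIES (`VHSData.tateTwist`, `VHSData.Hom.tateTwist`, `VHSData.Hom.tateTwistZero`, `VHSData.Hom.ofTateTwistZero`,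
`VHSData.Hom.tateTwistAdd`, `VHSData.Hom.ofTateTwistAdd`) and their API; no named fact, no instance, no notation (D-0026 net debt `0`).  Sequel of
`Motives/FamiliesVHSHom` (`VHSData.cast`) and `Motives/FamiliesVHSMorphism` (`VHSData.Hom`); the Hodge-theoretic input is the tree's
`HodgeStructure.tateTwist` (`Motives/HodgeTensor`: `F^p H(j) = F^{p+j} H`), `Polarization.tateTwist` (`Motives/HodgeStructureDirectSum`: the same
form polarizes `H(j)`) and `tateTwist_hodgeClasses` (`Hdgᵖ(H(j)) = Hdg^{p+j}(H)`).

PRINTED SOURCES.  P. Deligne, *Théorie de Hodge II*, Publ. Math. IHÉS 40 (1971), 2.1.13–2.1.14: the Tate structure `ℤ(1)` and the Tate twists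
`H(n) = H ⊗ ℤ(n)` of a Hodge structure (weight `w − 2n`, `H(n)^{p,q} = H^{p+n,q+n}`); (2.1.15) polarizations.  J. Carlson, S. Müller-Stach, C. Peters,
*Period Mappings and Period Domains* (2nd ed., 2017), Examples 1.2.6 (ii) (Tate twists), §4.6 (variations of Hodge structure).  W. Schmid, *Variation
of Hodge structure*, Invent. Math. 22 (1973), §2 (polarized variations are stable under the tensor operations).  B. Klingler, A. Otwinowska, D. Urbanik, *On
the fields of definition of Hodge loci*, Ann. Sci. ÉNS 56 (2023), §1.1.1 («a weight zero polarizable variation of Hodge structure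
`𝕍 := R^{2k}f_*ℤ(k)` … Hodge classes `λ ∈ F⁰𝒱 ∩ 𝕍_ℚ`») ∕ E. Cattani, P. Deligne, A. Kaplan, *On the locus of Hodge classes*, J. AMS 8 (1995), §1: the
locus of Hodge classes of type `(p, p)` of a variation of weight `2p` is that of the classes of type `(0,0)` of its twist by `ℤ(p)` (weight `0`).

* §1 **`VHSData.tateTwist D j : VHSData S (k − 2j)`** — the same integral ∕ rational local systems and comparison, on each fibre the twisted Hodge
  structure `(V_s, F)(j)` (the tree's `HodgeStructure.tateTwist`) polarized by the SAME form (`Polarization.tateTwist`), flat as before.  `rfl` API: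
  `tateTwist_VZ`, `tateTwist_V`, `tateTwist_toRat`, `tateTwist_hodge`, `tateTwist_form_form`, `tateTwist_VZ_transport`.
* §2 Hodge classes and loci: **`isHodgeAt_tateTwist_iff`** (`u ∈ V_ℤ,s` is Hodge of level `p` for `D(j)` iff of level `p + j` for `D`),
  **`isHodgeAt_tateTwist_zero_iff`** (weight `2p`, level `p` ⟺ weight `0`, level `0` after twisting by `p`), **`hodgeLocusOfNormLe_tateTwist`**
  (`HL(D(j), p, K) = HL(D, p + j, K)`), `hodgeLocusOfNormLe_eq_tateTwist` (the CDK locus of `D` in level `p` is the level-`0` locus of `D(p)`),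
  `setOf_exists_isHodgeAt_transport_tateTwist` (determination loci).
* §3 morphisms: **`Hom.tateTwist φ j : Hom (D₁.tateTwist j) (D₂.tateTwist j)`** (same lattice maps); the canonical identifications
  `Hom.tateTwistZero ∕ Hom.ofTateTwistZero : D(0) ⇄ D` and `Hom.tateTwistAdd ∕ Hom.ofTateTwistAdd : D(i)(j) ⇄ D(i + j)` (identity lattice maps,
  weights matched by `cast`), all with `app = id`.

HONEST SCOPE: as for every `VHSData`, holomorphy ∕ transversality are not recorded (they are insensitive to Tate twists).  The identification
`D(j) ≅ D ⊗ ℤ_S(j)` with the Tate variation is not in this file.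

## References

* [DeligneHodgeII1971] P. Deligne, *Théorie de Hodge II*, Publ. Math. IHÉS 40 (1971), 2.1.13–2.1.15.
* [CarlsonMullerStachPeters2017] J. Carlson, S. Müller-Stach, C. Peters, *Period Mappings and Period Domains*, 2nd ed., CUP (2017), Examples 1.2.6 (ii),
  §4.6.
* [Schmid1973] W. Schmid, *Variation of Hodge structure: the singularities of the period mapping*, Invent. Math. 22 (1973), §2.
* [CattaniDeligneKaplan1995] E. Cattani, P. Deligne, A. Kaplan, *On the locus of Hodge classes*, J. Amer. Math. Soc. 8 (1995), §1.
* [KlinglerOtwinowskaUrbanik2023] B. Klingler, A. Otwinowska, D. Urbanik, *On the fields of definition of Hodge loci*, Ann. Sci. ÉNS 56 (2023), §1.1.1.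
-/

noncomputable section

open CategoryTheory
open scoped TensorProduct

namespace Literature.AlgebraicGeometry.Motives

namespace VHSData

variable {S : Type} [TopologicalSpace S] {k : ℤ}

/-! ## §1 The Tate twist of a VHS datum -/

/-- **The Tate twist `D(j)` of the data of a polarized variation of Hodge structure** of weight `k` (Deligne, Hodge II 2.1.13–2.1.14 fibrewise): the
same local systems `V_ℤ`, `V` and comparison, on each fibre the twisted Hodge structure `(V_s, F)(j)` of weight `k − 2j` (`F^p V_s(j) = F^{p+j} V_s`,
the tree's `HodgeStructure.tateTwist`) polarized by the same form `Q_s` (the tree's `Polarization.tateTwist`: the weight changes by the even number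
`2j` and the Hodge–Riemann relations shift with the pieces), flat as for `D`. [cite: DeligneHodgeII1971, 2.1.13–2.1.14] [cite: Schmid1973, §2]
[cite: CarlsonMullerStachPeters2017, Examples 1.2.6 (ii)] -/
def tateTwist (D : VHSData S k) (j : ℤ) : VHSData S (k - 2 * j) where
  VZ := D.VZ
  V := D.V
  ratIso := D.ratIso
  hodge s := (D.hodge s).tateTwist j
  form s := (D.form s).tateTwist j
  transport_form := D.transport_form
  finite_free := D.finite_free

variable (D : VHSData S k) (j : ℤ)

/-- `D(j)` has the integral local system of `D`. [cite: DeligneHodgeII1971, 2.1.14] -/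
@[simp] theorem tateTwist_VZ : (D.tateTwist j).VZ = D.VZ := rfl

/-- `D(j)` has the rational local system of `D`. [cite: DeligneHodgeII1971, 2.1.14] -/
@[simp] theorem tateTwist_V : (D.tateTwist j).V = D.V := rfl

/-- `D(j)` has the comparison `V_ℤ → V` of `D`. [cite: Schmid1973, §2] -/
@[simp] theorem tateTwist_toRat (s : S) : (D.tateTwist j).toRat s = D.toRat s := rfl

/-- The Hodge structure of `D(j)` at `s` is the Tate twist `(V_s, F)(j)`. [cite: DeligneHodgeII1971, 2.1.14] -/
theorem tateTwist_hodge (s : S) : (D.tateTwist j).hodge s = (D.hodge s).tateTwist j := rfl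

/-- The Hodge filtration of `D(j)` at `s`: `F^p V_s(j) = F^{p+j} V_s`. [cite: DeligneHodgeII1971, 2.1.14] -/
theorem tateTwist_hodge_F (s : S) (p : ℤ) : ((D.tateTwist j).hodge s).F p = (D.hodge s).F (p + j) := rfl

/-- The polarization form of `D(j)` at `s` is that of `D`. [cite: DeligneHodgeII1971, 2.1.15] -/
theorem tateTwist_form_form (s : S) : ((D.tateTwist j).form s).form = (D.form s).form := rfl

/-- Integral transport of `D(j)` is that of `D`. [cite: Schmid1973, §2] -/
theorem tateTwist_VZ_transport {s t : S} (γ : Path.Homotopic.Quotient s t) : (D.tateTwist j).VZ.transport γ = D.VZ.transport γ := rfl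

/-- Rational transport of `D(j)` is that of `D`. [cite: Schmid1973, §2] -/
theorem tateTwist_V_transport {s t : S} (γ : Path.Homotopic.Quotient s t) : (D.tateTwist j).V.transport γ = D.V.transport γ := rfl

/-! ## §2 Hodge classes and Hodge loci of a Tate twist -/

/-- **Integral Hodge classes of `D(j)`**: `u ∈ V_ℤ,s` is a Hodge class of level `p` for `D(j)` iff it is a Hodge class of level `p + j` for `D`
(`Hdgᵖ(H(j)) = Hdg^{p+j}(H)`, the tree's `tateTwist_hodgeClasses`). [cite: DeligneHodgeII1971, 2.1.14] [cite: CattaniDeligneKaplan1995, §1] -/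
theorem isHodgeAt_tateTwist_iff (s : S) (p : ℤ) (u : D.VZ.fiber s) : (D.tateTwist j).IsHodgeAt s p u ↔ D.IsHodgeAt s (p + j) u := Iff.rfl

/-- **Weight `2p`, level `p` ⟺ weight `0`, level `0` after twisting by `p`**: `u` is a Hodge class of level `0` for `D(p)` iff it is a Hodge class of
level `p` for `D` — the reduction of the locus of Hodge classes of type `(p, p)` to classes of type `(0, 0)`. [cite: KlinglerOtwinowskaUrbanik2023, §1.1.1]
[cite: CattaniDeligneKaplan1995, §1] -/
theorem isHodgeAt_tateTwist_zero_iff (s : S) (p : ℤ) (u : D.VZ.fiber s) : (D.tateTwist p).IsHodgeAt s 0 u ↔ D.IsHodgeAt s p u := by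
  rw [isHodgeAt_tateTwist_iff, zero_add]

/-- Determinations: `γ_* u` is Hodge of level `p` for `D(j)` at `t` iff it is Hodge of level `p + j` for `D` (same transport). [cite: CattaniDeligneKaplan1995, §1] -/
theorem isHodgeAt_tateTwist_transport_iff {s t : S} (γ : Path.Homotopic.Quotient s t) (p : ℤ) (u : D.VZ.fiber s) :
    (D.tateTwist j).IsHodgeAt t p ((D.tateTwist j).VZ.transport γ u) ↔ D.IsHodgeAt t (p + j) (D.VZ.transport γ u) := Iff.rfl

/-- **The Hodge loci of `D(j)`**: `HL(D(j); p, K) = HL(D; p + j, K)` (same integral vectors, same form, shifted level). [cite: CattaniDeligneKaplan1995, §1, Thm. 1.1]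
[cite: KlinglerOtwinowskaUrbanik2023, §1.1.1] -/
theorem hodgeLocusOfNormLe_tateTwist (p K : ℤ) : (D.tateTwist j).hodgeLocusOfNormLe p K = D.hodgeLocusOfNormLe (p + j) K := rfl

/-- **The CDK locus of `D` in level `p` is the level-`0` locus of `D(p)`.** [cite: CattaniDeligneKaplan1995, §1, Thm. 1.1] [cite: KlinglerOtwinowskaUrbanik2023, §1.1.1] -/
theorem hodgeLocusOfNormLe_eq_tateTwist (p K : ℤ) : D.hodgeLocusOfNormLe p K = (D.tateTwist p).hodgeLocusOfNormLe 0 K := by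
  rw [hodgeLocusOfNormLe_tateTwist, zero_add]

/-- Determination loci of `D(j)` in level `p` are those of `D` in level `p + j`. [cite: CattaniDeligneKaplan1995, §1, Cor. 1.3] -/
theorem setOf_exists_isHodgeAt_transport_tateTwist (s : S) (p : ℤ) (u : D.VZ.fiber s) :
    {t : S | ∃ γ : Path.Homotopic.Quotient s t, (D.tateTwist j).IsHodgeAt t p ((D.tateTwist j).VZ.transport γ u)} =
      {t : S | ∃ γ : Path.Homotopic.Quotient s t, D.IsHodgeAt t (p + j) (D.VZ.transport γ u)} := rfl

/-- The self-intersection of an integral vector is unchanged by twisting. [cite: DeligneHodgeII1971, 2.1.15] -/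
theorem tateTwist_form_toRat (s : S) (u v : D.VZ.fiber s) :
    ((D.tateTwist j).form s).form ((D.tateTwist j).toRat s u) ((D.tateTwist j).toRat s v) = (D.form s).form (D.toRat s u) (D.toRat s v) := rfl

/-! ## §3 Twists of morphisms; `D(0) ⇄ D`, `D(i)(j) ⇄ D(i + j)` -/

variable {D} {D₁ D₂ : VHSData S k}

/-- `homRat` does not see Tate twists or weight casts (it only depends on the local systems and comparisons). [cite: Schmid1973, §2] -/
theorem homRat_tateTwist (i j : ℤ) (s : S) (f : D₁.VZ.fiber s →ₗ[ℤ] D₂.VZ.fiber s) :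
    (D₁.tateTwist i).homRat (D₂.tateTwist j) s f = D₁.homRat D₂ s f := rfl

/-- **The Tate twist `φ(j) : D₁(j) → D₂(j)` of a morphism** (same lattice maps; the Hodge condition shifts with the filtrations: Deligne, Hodge II
2.1.14, `Hom.tateTwist` of the tree fibrewise). [cite: DeligneHodgeII1971, 2.1.14] [cite: Schmid1973, §2] -/
def Hom.tateTwist (φ : Hom D₁ D₂) (j : ℤ) : Hom (D₁.tateTwist j) (D₂.tateTwist j) where
  fZ := φ.fZ
  map_F_le s p := φ.map_F_le s (p + j)

/-- `φ(j)` has the lattice maps of `φ`. [cite: DeligneHodgeII1971, 2.1.14] -/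
@[simp] theorem Hom.tateTwist_app (φ : Hom D₁ D₂) (j : ℤ) (s : S) : (φ.tateTwist j).app s = φ.app s := rfl

/-- `(ψ ∘ φ)(j) = ψ(j) ∘ φ(j)`. [cite: DeligneHodgeII1971, 2.1.14] -/
theorem Hom.tateTwist_comp {D₃ : VHSData S k} (ψ : Hom D₂ D₃) (φ : Hom D₁ D₂) (j : ℤ) :
    (ψ.comp φ).tateTwist j = (ψ.tateTwist j).comp (φ.tateTwist j) := rfl

/-- `id(j) = id`. [cite: DeligneHodgeII1971, 2.1.14] -/
theorem Hom.tateTwist_id (D : VHSData S k) (j : ℤ) : (Hom.id D).tateTwist j = Hom.id (D.tateTwist j) := rfl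

/-- **`D(0) → D`** (identity lattice maps; `F^p V(0) = F^{p+0} V = F^p V`), the target weight `k − 2·0` matched to `k` by `cast`.
[cite: DeligneHodgeII1971, 2.1.14] -/
def Hom.tateTwistZero (D : VHSData S k) : Hom (D.tateTwist 0) (D.cast (by ring)) where
  fZ := 𝟙 D.VZ
  map_F_le s p := by
    change ((D.hodge s).F (p + 0)).map ((D.homRat D s LinearMap.id).baseChange ℂ) ≤ (D.hodge s).F p
    rw [homRat_id, LinearMap.baseChange_id, Submodule.map_id, add_zero]

/-- **`D → D(0)`**, inverse to `Hom.tateTwistZero`. [cite: DeligneHodgeII1971, 2.1.14] -/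
def Hom.ofTateTwistZero (D : VHSData S k) : Hom (D.cast (by ring)) (D.tateTwist 0) where
  fZ := 𝟙 D.VZ
  map_F_le s p := by
    change ((D.hodge s).F p).map ((D.homRat D s LinearMap.id).baseChange ℂ) ≤ (D.hodge s).F (p + 0)
    rw [homRat_id, LinearMap.baseChange_id, Submodule.map_id, add_zero]

/-- `Hom.tateTwistZero` is the identity on lattices. [cite: DeligneHodgeII1971, 2.1.14] -/
@[simp] theorem Hom.tateTwistZero_app (D : VHSData S k) (s : S) : (Hom.tateTwistZero D).app s = LinearMap.id := rfl

/-- `Hom.ofTateTwistZero` is the identity on lattices. [cite: DeligneHodgeII1971, 2.1.14] -/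
@[simp] theorem Hom.ofTateTwistZero_app (D : VHSData S k) (s : S) : (Hom.ofTateTwistZero D).app s = LinearMap.id := rfl

/-- `D(0) → D → D(0)` is the identity. [cite: DeligneHodgeII1971, 2.1.14] -/
theorem Hom.ofTateTwistZero_comp_tateTwistZero (D : VHSData S k) :
    (Hom.ofTateTwistZero D).comp (Hom.tateTwistZero D) = Hom.id (D.tateTwist 0) :=
  Hom.ext_of_app _ _ fun _ => LinearMap.ext fun _ => rfl

/-- `D → D(0) → D` is the identity. [cite: DeligneHodgeII1971, 2.1.14] -/
theorem Hom.tateTwistZero_comp_ofTateTwistZero (D : VHSData S k) :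
    (Hom.tateTwistZero D).comp (Hom.ofTateTwistZero D) = Hom.id (D.cast (by ring)) :=
  Hom.ext_of_app _ _ fun _ => LinearMap.ext fun _ => rfl

/-- **`D(i)(j) → D(i + j)`** (identity lattice maps; `F^p V(i)(j) = F^{p+j+i} V = F^{p+(i+j)} V`), weights matched by `cast`.
[cite: DeligneHodgeII1971, 2.1.14] -/
def Hom.tateTwistAdd (D : VHSData S k) (i j : ℤ) : Hom ((D.tateTwist i).tateTwist j) ((D.tateTwist (i + j)).cast (by ring)) where
  fZ := 𝟙 D.VZ
  map_F_le s p := by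
    change ((D.hodge s).F (p + j + i)).map ((D.homRat D s LinearMap.id).baseChange ℂ) ≤ (D.hodge s).F (p + (i + j))
    rw [homRat_id, LinearMap.baseChange_id, Submodule.map_id, show p + j + i = p + (i + j) by ring]

/-- **`D(i + j) → D(i)(j)`**, inverse to `Hom.tateTwistAdd`. [cite: DeligneHodgeII1971, 2.1.14] -/
def Hom.ofTateTwistAdd (D : VHSData S k) (i j : ℤ) : Hom ((D.tateTwist (i + j)).cast (by ring)) ((D.tateTwist i).tateTwist j) where
  fZ := 𝟙 D.VZ
  map_F_le s p := by
    change ((D.hodge s).F (p + (i + j))).map ((D.homRat D s LinearMap.id).baseChange ℂ) ≤ (D.hodge s).F (p + j + i)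
    rw [homRat_id, LinearMap.baseChange_id, Submodule.map_id, show p + j + i = p + (i + j) by ring]

/-- `Hom.tateTwistAdd` is the identity on lattices. [cite: DeligneHodgeII1971, 2.1.14] -/
@[simp] theorem Hom.tateTwistAdd_app (D : VHSData S k) (i j : ℤ) (s : S) : (Hom.tateTwistAdd D i j).app s = LinearMap.id := rfl

/-- `Hom.ofTateTwistAdd` is the identity on lattices. [cite: DeligneHodgeII1971, 2.1.14] -/
@[simp] theorem Hom.ofTateTwistAdd_app (D : VHSData S k) (i j : ℤ) (s : S) : (Hom.ofTateTwistAdd D i j).app s = LinearMap.id := rfl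

/-- `D(i)(j) → D(i + j) → D(i)(j)` is the identity. [cite: DeligneHodgeII1971, 2.1.14] -/
theorem Hom.ofTateTwistAdd_comp_tateTwistAdd (D : VHSData S k) (i j : ℤ) :
    (Hom.ofTateTwistAdd D i j).comp (Hom.tateTwistAdd D i j) = Hom.id ((D.tateTwist i).tateTwist j) :=
  Hom.ext_of_app _ _ fun _ => LinearMap.ext fun _ => rfl

/-- `D(i + j) → D(i)(j) → D(i + j)` is the identity. [cite: DeligneHodgeII1971, 2.1.14] -/
theorem Hom.tateTwistAdd_comp_ofTateTwistAdd (D : VHSData S k) (i j : ℤ) :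
    (Hom.tateTwistAdd D i j).comp (Hom.ofTateTwistAdd D i j) = Hom.id ((D.tateTwist (i + j)).cast (by ring)) :=
  Hom.ext_of_app _ _ fun _ => LinearMap.ext fun _ => rfl

/-- Pull-back commutes with Tate twists (fibres, transports, Hodge structures and forms agree); stated on `toRat`. [cite: Schmid1973, §2] -/
theorem comap_tateTwist_toRat {S' : Type} [TopologicalSpace S'] (f : C(S', S)) (D : VHSData S k) (j : ℤ) (s' : S') :
    ((D.comap f).tateTwist j).toRat s' = ((D.tateTwist j).comap f).toRat s' := rfl

end VHSData

end Literature.AlgebraicGeometry.Motives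

end
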